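import Summits.Ventures.PercRepro.Night2LocalFarTrace
import Summits.Ventures.PercRepro.Night2LocalTwoSplit
import Summits.Ventures.PercRepro.Night2LocalFullMatching
import Summits.Ventures.PercRepro.Night2LocalDyadic

/-!
# PercRepro — the three-layer rule with distance-2 routing: definitions (night-2, gen 8)

The explicit fractional matching of `proofs/NIGHT-2-local.md` §17(c)/(k0), for the full family of bottom sets
below a rank-`(q+1)` flat `G` with `d = |E ∖ G| ≤ q`:

* layer 0: the «layer-0» members (`|G ∖ cl B| = 1`, so `|E ∖ cl B| = 1 + d ≤ q + 1`) take their whole demand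
  `Φ/(1+d)` from their single covering set (`w0`);
* layer 1: every other member requests `Φ/|E ∖ cl B|` from each covering set, and a covering set `S` serves the
  fraction `fS S = min(1, capS S / L1 S)` of every request, where `capS S = 1 − k1 S · Φ/(1+d)` is what layer 0
  leaves and `L1 S` is the total request (`w1`);
* layer 2: the loss `req B · (1 − fS (B ∪ {z}))` of a member at a covering set is spread equally over the
  `|G ∖ cl B| − 1` sets `B ∪ {z, z'}` (`w2`).

**`localShadowHall_of_distance_two`**: rows are exact (`row_w_eq_dem`) and the column sum at `S` is
`1 − cap2 S + load2 S`, so the local form (LI_G) holds as soon as `load2 S ≤ cap2 S` at every shadow set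
(`cap2 S = capS S − fS S · L1 S` is the residual capacity).  Theorem E of §17(k) verifies that column condition
at `d = q` with few coloops on paper; this file is its matching-side half, valid for every `d ≤ q`.
The nonnegativity of `capS` is Lemma A (`card_coloopMembers_le`): the layer-0 preimages of `S` inject into the
coloop members of `S`, so `k1 S ≤ d` and `capS S ≥ (q+1−d)/((q+1)(d+1)) ≥ 0`.
-/

namespace PercRepro.Shadow

open Finset PerFlat ThmH

variable {α : Type*} [DecidableEq α] {M : Matroid α} [M.Finite]

/-! ## The ingredients -/

/-- The constant `Φ = (q+2)/(q+1)`. -/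
def phiQ (q : ℕ) : ℚ := ((q : ℚ) + 2) / ((q : ℚ) + 1)

/-- The request of a member: `Φ / |E ∖ cl B|`. -/
noncomputable def req (M : Matroid α) [M.Finite] (q : ℕ) (B : Finset α) : ℚ :=
  phiQ q / ((gr M \ clF M B).card : ℚ)

open scoped Classical in
/-- The layer-0 members below `G`: `|G ∖ cl B| = 1` and fat (`1 + d ≤ q + 1`). -/
noncomputable def lay0 (M : Matroid α) [M.Finite] (q : ℕ) (G : Finset α) : Finset (Finset α) :=
  (membersIn M (Uq M (q + 2) q) G).filter
    (fun B => (G \ clF M B).card = 1 ∧ 1 + (gr M \ G).card ≤ q + 1)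

open scoped Classical in
/-- The number of layer-0 covering preimages of `S`. -/
noncomputable def k1 (M : Matroid α) [M.Finite] (q : ℕ) (G S : Finset α) : ℕ :=
  ((coverPreimages M (Uq M (q + 2) q) G S).filter (fun B => B ∈ lay0 M q G)).card

/-- The capacity left by layer 0 at `S`. -/
noncomputable def capS (M : Matroid α) [M.Finite] (q : ℕ) (G S : Finset α) : ℚ :=
  1 - (k1 M q G S : ℚ) * phiQ q / (1 + ((gr M \ G).card : ℚ))

open scoped Classical in
/-- The total layer-1 request at `S`. -/
noncomputable def L1 (M : Matroid α) [M.Finite] (q : ℕ) (G S : Finset α) : ℚ :=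
  ∑ B ∈ (coverPreimages M (Uq M (q + 2) q) G S).filter (fun B => B ∉ lay0 M q G), req M q B

/-- The served fraction at `S`. -/
noncomputable def fS (M : Matroid α) [M.Finite] (q : ℕ) (G S : Finset α) : ℚ :=
  if L1 M q G S ≤ capS M q G S then 1 else capS M q G S / L1 M q G S

/-- The residual capacity after layers 0 and 1. -/
noncomputable def cap2 (M : Matroid α) [M.Finite] (q : ℕ) (G S : Finset α) : ℚ :=
  capS M q G S - fS M q G S * L1 M q G S

open scoped Classical in
/-- Layer 0. -/
noncomputable def w0 (M : Matroid α) [M.Finite] (q : ℕ) (G B S : Finset α) : ℚ :=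
  if B ∈ lay0 M q G ∧ S ∈ coverSets M B G then phiQ q / (1 + ((gr M \ G).card : ℚ)) else 0

open scoped Classical in
/-- Layer 1. -/
noncomputable def w1 (M : Matroid α) [M.Finite] (q : ℕ) (G B S : Finset α) : ℚ :=
  if B ∉ lay0 M q G ∧ S ∈ coverSets M B G then req M q B * fS M q G S else 0

/-- The loss of `B` at its covering set `B ∪ {z}`. -/
noncomputable def loss (M : Matroid α) [M.Finite] (q : ℕ) (G B : Finset α) (z : α) : ℚ :=
  req M q B * (1 - fS M q G (insert z B))

open scoped Classical in
/-- Layer 2: the losses at `B ∪ {z}` and `B ∪ {z'}`, each spread over `|G ∖ cl B| − 1` sets. -/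
noncomputable def w2 (M : Matroid α) [M.Finite] (q : ℕ) (G B S : Finset α) : ℚ :=
  if B ∉ lay0 M q G ∧ B ⊆ S ∧ S \ B ⊆ G \ clF M B ∧ (S \ B).card = 2 then
    (∑ z ∈ S \ B, loss M q G B z) / (((G \ clF M B).card : ℚ) - 1)
  else 0

/-- The whole rule. -/
noncomputable def wRule (M : Matroid α) [M.Finite] (q : ℕ) (G B S : Finset α) : ℚ :=
  w0 M q G B S + w1 M q G B S + w2 M q G B S

open scoped Classical in
/-- The layer-2 load at `S`. -/
noncomputable def load2 (M : Matroid α) [M.Finite] (q : ℕ) (G S : Finset α) : ℚ :=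
  ∑ B ∈ membersIn M (Uq M (q + 2) q) G, w2 M q G B S

/-! ## Basic facts -/

omit [DecidableEq α] [M.Finite] in
/-- `Φ > 0`. -/
theorem phiQ_pos (q : ℕ) : 0 < phiQ q := by unfold phiQ; positivity

/-- Requests are nonnegative. -/
theorem req_nonneg (q : ℕ) (B : Finset α) : 0 ≤ req M q B := by
  unfold req
  exact div_nonneg (phiQ_pos q).le (by positivity)

open scoped Classical in
/-- Layer-0 members have `|G ∖ cl B| = 1` and are fat. -/
theorem mem_lay0 {q : ℕ} {G B : Finset α} :
    B ∈ lay0 M q G ↔ B ∈ membersIn M (Uq M (q + 2) q) G ∧ (G \ clF M B).card = 1 ∧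
      1 + (gr M \ G).card ≤ q + 1 := by
  unfold lay0; rw [Finset.mem_filter]

open scoped Classical in
/-- The layer-0 covering preimages of `S` inject into its coloop members, so `k1 S ≤ |E ∖ G|` (Lemma A). -/
theorem k1_le {q : ℕ} {G : Finset α} (hG : G ∈ flatsQ M (q + 1)) {S : Finset α} (hS : S ⊆ G) :
    k1 M q G S ≤ (gr M \ G).card := by
  refine le_trans ?_ (card_coloopMembers_le hG hS)
  unfold k1
  -- map B ↦ the element of S ∖ B
  have key : ∀ B ∈ (coverPreimages M (Uq M (q + 2) q) G S).filter (fun B => B ∈ lay0 M q G),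
      ∃ y, S = insert y B ∧ y ∈ coloopMembers M q G S ∧ y ∉ B := by
    intro B hB
    rw [Finset.mem_filter, mem_coverPreimages] at hB
    obtain ⟨⟨hBm, hcov⟩, hB0⟩ := hB
    obtain ⟨z, hz, rfl⟩ := mem_coverSets.1 hcov
    have hBU : B ∈ Uq M (q + 2) q := (mem_membersIn.1 hBm).1
    have hzB : z ∉ B := notMem_of_notMem_clF hBU (Finset.mem_sdiff.1 hz).2
    refine ⟨z, rfl, ?_, hzB⟩
    rw [mem_coloopMembers]
    refine ⟨Finset.mem_insert_self _ _, ?_, by rw [Finset.erase_insert hzB]; exact hBU⟩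
    -- G ∖ cl B = {z}, so cl B = G.erase z and z ∉ cl (G.erase z) = cl (cl B) = cl B
    have h1 : (G \ clF M B).card = 1 := (mem_lay0.1 hB0).2.1
    have hBG : clF M B ⊆ G := (mem_membersIn.1 hBm).2
    have hsing : G \ clF M B = {z} := by
      rw [Finset.card_eq_one] at h1
      obtain ⟨a, ha⟩ := h1
      rw [ha] at hz ⊢
      rw [Finset.mem_singleton] at hz
      rw [hz]
    have hGe : G.erase z = clF M B := by
      ext e
      rw [Finset.mem_erase]
      constructor
      · rintro ⟨hez, heG⟩
        by_contra hecl
        have : e ∈ G \ clF M B := Finset.mem_sdiff.2 ⟨heG, hecl⟩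
        rw [hsing, Finset.mem_singleton] at this
        exact hez this
      · intro hecl
        refine ⟨fun h => ?_, hBG hecl⟩
        rw [h] at hecl
        exact (Finset.mem_sdiff.1 hz).2 hecl
    rw [hGe]
    intro hzcl
    -- clF (clF B) = clF B
    have hidem : clF M (clF M B) = clF M B := by
      rw [← Finset.coe_inj, coe_clF, coe_clF, Matroid.closure_closure]
    rw [hidem] at hzcl
    exact (Finset.mem_sdiff.1 hz).2 hzcl
  have hinj : Set.InjOn (fun B : Finset α => S \ B)
      ((coverPreimages M (Uq M (q + 2) q) G S).filter (fun B => B ∈ lay0 M q G) : Set (Finset α)) := by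
    intro B hB B' hB' hBB'
    have h1 : B ⊆ S := by
      obtain ⟨y, hy, -, -⟩ := key B hB
      rw [hy]; exact Finset.subset_insert _ _
    have h2 : B' ⊆ S := by
      obtain ⟨y, hy, -, -⟩ := key B' hB'
      rw [hy]; exact Finset.subset_insert _ _
    have h3 : S \ B = S \ B' := hBB'
    calc B = S \ (S \ B) := (Finset.sdiff_sdiff_eq_self h1).symm
      _ = S \ (S \ B') := by rw [h3]
      _ = B' := Finset.sdiff_sdiff_eq_self h2
  rw [← Finset.card_image_of_injOn hinj]
  refine le_trans (Finset.card_le_card ?_) (Finset.card_image_le (f := fun y : α => ({y} : Finset α)))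
  intro T hT
  rw [Finset.mem_image] at hT ⊢
  obtain ⟨B, hB, rfl⟩ := hT
  obtain ⟨y, hy, hyc, hyB⟩ := key B hB
  refine ⟨y, hyc, ?_⟩
  rw [hy, Finset.insert_sdiff_of_notMem _ hyB, Finset.sdiff_self, Finset.insert_empty]

/-! ## Nonnegativity and the served fraction -/

omit [DecidableEq α] [M.Finite] in
/-- `d · Φ ≤ 1 + d` when `d ≤ q + 1`. -/
theorem mul_phiQ_le {q d : ℕ} (hd : d ≤ q + 1) : (d : ℚ) * phiQ q ≤ 1 + (d : ℚ) := by
  unfold phiQ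
  have hq : (0 : ℚ) < (q : ℚ) + 1 := by positivity
  rw [mul_div_assoc', div_le_iff₀ hq]
  have : (d : ℚ) ≤ (q : ℚ) + 1 := by exact_mod_cast hd
  nlinarith

/-- `capS S ≥ 0` when `|E ∖ G| ≤ q` (Lemma A). -/
theorem capS_nonneg {q : ℕ} {G : Finset α} (hG : G ∈ flatsQ M (q + 1)) (hd : (gr M \ G).card ≤ q)
    {S : Finset α} (hS : S ⊆ G) : 0 ≤ capS M q G S := by
  unfold capS
  have hk : (k1 M q G S : ℚ) ≤ ((gr M \ G).card : ℚ) := by exact_mod_cast k1_le hG hS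
  have hpos : (0 : ℚ) < 1 + ((gr M \ G).card : ℚ) := by positivity
  have h1 : ((gr M \ G).card : ℚ) * phiQ q ≤ 1 + ((gr M \ G).card : ℚ) :=
    mul_phiQ_le (by omega)
  have h2 : (k1 M q G S : ℚ) * phiQ q ≤ ((gr M \ G).card : ℚ) * phiQ q :=
    mul_le_mul_of_nonneg_right hk (phiQ_pos q).le
  rw [sub_nonneg, div_le_one hpos]
  exact h2.trans h1

/-- The layer-1 request at `S` is nonnegative. -/
theorem L1_nonneg (q : ℕ) (G S : Finset α) : 0 ≤ L1 M q G S := by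
  unfold L1
  exact Finset.sum_nonneg (fun B _ => req_nonneg q B)

/-- The served fraction is nonnegative when `capS S ≥ 0`. -/
theorem fS_nonneg {q : ℕ} {G S : Finset α} (hcap : 0 ≤ capS M q G S) : 0 ≤ fS M q G S := by
  unfold fS
  split_ifs with h
  · exact zero_le_one
  · exact div_nonneg hcap (L1_nonneg q G S)

/-- The served fraction is at most `1` when `capS S ≥ 0`. -/
theorem fS_le_one {q : ℕ} {G S : Finset α} (hcap : 0 ≤ capS M q G S) : fS M q G S ≤ 1 := by
  unfold fS
  split_ifs with h
  · exact le_refl _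
  · push Not at h
    exact (div_le_one (hcap.trans_lt h)).2 h.le

/-- The served amount never exceeds the capacity. -/
theorem fS_mul_L1_le {q : ℕ} {G S : Finset α} (hcap : 0 ≤ capS M q G S) :
    fS M q G S * L1 M q G S ≤ capS M q G S := by
  unfold fS
  split_ifs with h
  · rw [one_mul]; exact h
  · push Not at h
    have hL : 0 < L1 M q G S := hcap.trans_lt h
    rw [div_mul_cancel₀ _ hL.ne']

/-- The residual capacity is nonnegative when `capS S ≥ 0`. -/
theorem cap2_nonneg {q : ℕ} {G S : Finset α} (hcap : 0 ≤ capS M q G S) : 0 ≤ cap2 M q G S := by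
  unfold cap2
  rw [sub_nonneg]
  exact fS_mul_L1_le hcap

/-- Losses are nonnegative. -/
theorem loss_nonneg {q : ℕ} {G B : Finset α} {z : α} (hcap : 0 ≤ capS M q G (insert z B)) :
    0 ≤ loss M q G B z := by
  unfold loss
  exact mul_nonneg (req_nonneg q B) (sub_nonneg.2 (fS_le_one hcap))

open scoped Classical in
/-- Layer 0 is nonnegative. -/
theorem w0_nonneg (q : ℕ) (G B S : Finset α) : 0 ≤ w0 M q G B S := by
  unfold w0
  split_ifs
  · exact div_nonneg (phiQ_pos q).le (by positivity)
  · exact le_refl _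

open scoped Classical in
/-- Layer 1 is nonnegative. -/
theorem w1_nonneg {q : ℕ} {G S : Finset α} (hcap : 0 ≤ capS M q G S) (B : Finset α) :
    0 ≤ w1 M q G B S := by
  unfold w1
  split_ifs
  · exact mul_nonneg (req_nonneg q B) (fS_nonneg hcap)
  · exact le_refl _

open scoped Classical in
/-- Layer 2 is nonnegative. -/
theorem w2_nonneg {q : ℕ} {G B S : Finset α} (hcap : ∀ z ∈ S \ B, 0 ≤ capS M q G (insert z B)) :
    0 ≤ w2 M q G B S := by
  unfold w2
  split_ifs with h
  · obtain ⟨-, -, hsub, hcard⟩ := h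
    have hm : 2 ≤ (G \ clF M B).card := hcard ▸ Finset.card_le_card hsub
    have hden : (0 : ℚ) < ((G \ clF M B).card : ℚ) - 1 := by
      have : (2 : ℚ) ≤ ((G \ clF M B).card : ℚ) := by exact_mod_cast hm
      linarith
    exact div_nonneg (Finset.sum_nonneg (fun z hz => loss_nonneg (hcap z hz))) hden.le
  · exact le_refl _

/-! ## Support -/

open scoped Classical in
/-- Layer 0 is supported on containment. -/
theorem subset_of_w0_ne {q : ℕ} {G B S : Finset α} (h : w0 M q G B S ≠ 0) : B ⊆ S := by
  unfold w0 at h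
  split_ifs at h with hc
  · obtain ⟨z, -, rfl⟩ := mem_coverSets.1 hc.2
    exact Finset.subset_insert _ _
  · exact absurd rfl h

open scoped Classical in
/-- Layer 1 is supported on containment. -/
theorem subset_of_w1_ne {q : ℕ} {G B S : Finset α} (h : w1 M q G B S ≠ 0) : B ⊆ S := by
  unfold w1 at h
  split_ifs at h with hc
  · obtain ⟨z, -, rfl⟩ := mem_coverSets.1 hc.2
    exact Finset.subset_insert _ _
  · exact absurd rfl h

open scoped Classical in
/-- Layer 2 is supported on containment. -/
theorem subset_of_w2_ne {q : ℕ} {G B S : Finset α} (h : w2 M q G B S ≠ 0) : B ⊆ S := by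
  unfold w2 at h
  split_ifs at h with hc
  · exact hc.2.1
  · exact absurd rfl h

open scoped Classical in
/-- The rule is supported on containment. -/
theorem subset_of_wRule_ne {q : ℕ} {G B S : Finset α} (h : wRule M q G B S ≠ 0) : B ⊆ S := by
  unfold wRule at h
  by_cases h0 : w0 M q G B S = 0
  · by_cases h1 : w1 M q G B S = 0
    · rw [h0, h1, zero_add, zero_add] at h
      exact subset_of_w2_ne h
    · exact subset_of_w1_ne h1
  · exact subset_of_w0_ne h0

end PercRepro.Shadow
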